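import Summits.ValiantsHypothesis.ValiantsHypothesis.Theorems.RefutationDegreeBeyondHessianNsJetCalibrationTranslated
import Summits.ValiantsHypothesis.ValiantsHypothesis.Theorems.RefutationDegreeBeyondHessianNsStubMrJetInstance

/-!
# Route `RefutationDegree`, crux `BeyondHessianNs` (stmt-ValiantsHypothesis-5641), line `Sketch` —
# the jet-form pipeline END TO END: Mignon–Ressayre's certificate recovered through `stub_polyJetEq`'s format

Helper file (no definitions).  Composing the landed `stub_mrJetInstance` (Mignon–Ressayre's Hessian minor
satisfies the five jet-form conditions of the open stub `stub_polyJetEq` at every size `m` with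
`2m + 1 ≤ n²`) with the landed jet-form calibration `exists_refutation_of_jet_identity` gives, for
`3 ≤ n` and `2m + 1 ≤ n²`, a Nullstellensatz refutation of `Rep(n,m)` with products of degree
`≤ m (2m + 2)` — the statement of the route's support item `MrCalibration` (there with `3(m+1)²`), now as
an OUTPUT of the crux line's pipeline: the format of `stub_polyJetEq` is exactly what the calibration
consumes, and the only thing missing for the crux is such a `Ψ̃` at size `m = ⌊n²/2⌋ + 1`.
-/

noncomputable section

-- single-conjunct layout: Sub = Summit, duplicated namespace component intended
set_option linter.dupNamespace false

namespace Summit.ValiantsHypothesis.ValiantsHypothesis.Theorems.RefutationDegreeBeyondHessianNs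

open MvPolynomial Matrix Literature.Computability.AlgebraicComplexity

/-- **Mignon–Ressayre through the jet pipeline** (registered stub `stub_mrViaJets` of line `Sketch`): for
`3 ≤ n`, `0 < m` and `2m + 1 ≤ n²`, the coefficient system `Rep(n,m)` has a Nullstellensatz refutation
with all products of degree `≤ m (2m + 2)`. -/
theorem stub_mrViaJets : ∀ (n m : ℕ), 3 ≤ n → 0 < m → 2 * m + 1 ≤ n ^ 2 →
    ∃ hh : (Fin n × Fin n →₀ ℕ) → MvPolynomial (Option (Fin n × Fin n) × (Fin m × Fin m)) ℂ,
      (∀ μ, (hh μ * MvPolynomial.coeff μ ((Matrix.of fun i j : Fin m =>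
          MvPolynomial.C (MvPolynomial.X (none, (i, j))) +
            ∑ e : Fin n × Fin n, MvPolynomial.X e * MvPolynomial.C (MvPolynomial.X (some e, (i, j))) :
          Matrix (Fin m) (Fin m) (MvPolynomial (Fin n × Fin n)
            (MvPolynomial (Option (Fin n × Fin n) × (Fin m × Fin m)) ℂ))).det -
          MvPolynomial.map MvPolynomial.C
            (Literature.Computability.AlgebraicComplexity.perPoly (Fin n) ℂ))).totalDegree ≤
          m * (2 * m + 2)) ∧
      ∑ μ ∈ ((Matrix.of fun i j : Fin m =>
          MvPolynomial.C (MvPolynomial.X (none, (i, j))) +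
            ∑ e : Fin n × Fin n, MvPolynomial.X e * MvPolynomial.C (MvPolynomial.X (some e, (i, j))) :
          Matrix (Fin m) (Fin m) (MvPolynomial (Fin n × Fin n)
            (MvPolynomial (Option (Fin n × Fin n) × (Fin m × Fin m)) ℂ))).det -
          MvPolynomial.map MvPolynomial.C
            (Literature.Computability.AlgebraicComplexity.perPoly (Fin n) ℂ)).support,
        hh μ * MvPolynomial.coeff μ ((Matrix.of fun i j : Fin m =>
          MvPolynomial.C (MvPolynomial.X (none, (i, j))) +
            ∑ e : Fin n × Fin n, MvPolynomial.X e * MvPolynomial.C (MvPolynomial.X (some e, (i, j))) :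
          Matrix (Fin m) (Fin m) (MvPolynomial (Fin n × Fin n)
            (MvPolynomial (Option (Fin n × Fin n) × (Fin m × Fin m)) ℂ))).det -
          MvPolynomial.map MvPolynomial.C
            (Literature.Computability.AlgebraicComplexity.perPoly (Fin n) ℂ)) = 1 := by
  intro n m hn hm h2
  obtain ⟨y, e, Ψ, hy, he, hΨD, hΨper, hΨvan⟩ := stub_mrJetInstance n m ⟨0, hm⟩ hn h2
  exact exists_refutation_of_jet_identity hm ⟨0, hm⟩ y hy e he Ψ hΨD hΨper hΨvan

end Summit.ValiantsHypothesis.ValiantsHypothesis.Theorems.RefutationDegreeBeyondHessianNs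

end
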